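import Literature.Topology.FourManifolds.HomotopySpheresGroup
import Literature.Topology.FourManifolds.HomotopySpheresBPOrder
import HarnessLib

/-!
# Milnor's exotic 7-sphere as a corollary of `|Θ₇| = 28` and the topological Poincaré conjecture

Topic `Literature/Topology/FourManifolds`; pure-proof companion of the wave-0 statement file
`SPC4Wave0.lean`. The named fact
`Literature.Topology.FourManifolds.exists_homeomorph_isEmpty_diffeomorph_sphere_seven` (**spc4.S12**,
Milnor, *On manifolds homeomorphic to the 7-sphere*, Ann. of Math. 64 (1956), Thm. 3, p. 403: "For
`k² ≢ 1 mod 7` the manifold `M⁷ₖ` is homeomorphic to `S⁷` but not diffeomorphic to `S⁷`"; verbatim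
Mathlib's `proof_wanted exists_homeomorph_isEmpty_diffeomorph_sphere_seven`) is reduced here to two
named facts the tree already carries, with the reduction PROVED:

* `Literature.Topology.FourManifolds.natCard_homotopySphereClass_seven` (`HCobordism.lean`;
  Kervaire–Milnor 1963, Thm. 1.2 and table p. 504: `|Θ₇| = 28`), through its proved corollary
  `Literature.Topology.FourManifolds.nontrivial_homotopySphereClass_seven_of` (`Θ₇` is nontrivial);
* `Literature.Topology.FourManifolds.nonempty_homeomorph_sphere_of_five_le` (`SPC4Wave0.lean`;
  generalised topological Poincaré conjecture, `n ≥ 5`, Smale 1961 / Newman 1966 / Connell 1967),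
  at `n = 7`, which turns "homotopy equivalent to `S⁷`" into "homeomorphic to `S⁷`" (Milnor's §2,
  Thm. 2, does this by Reeb's two-critical-points criterion instead).

The key step is the tree's proved theorem
`Literature.Topology.FourManifolds.HomotopySphereClass.subsingleton_of_nonempty_diffeomorph_sphere`
(`HomotopySpheresGroup.lean`): if every homotopy `n`-sphere (`n ≠ 0`) is diffeomorphic to `𝕊ⁿ` then
`Θₙ` is a point. Contrapositively a nontrivial `Θ₇` contains the class of a homotopy `7`-sphere
whose carrier is not diffeomorphic to `𝕊⁷`; that carrier is the required exotic sphere.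

Also recorded: **spc4.S32** (negative part),
`Literature.Topology.FourManifolds.not_forall_nonemptyDiffeomorphSphere_seven` ("the smooth Poincaré
conjecture fails in dimension `7`"), follows from spc4.S12 outright and is equivalent to it granted
the topological Poincaré conjecture in dimension `7`
(`exists_homeomorph_isEmpty_diffeomorph_sphere_seven_iff_not_forall`).

## Main statements (all proved; no new named facts)

* `exists_homeomorph_isEmpty_diffeomorph_sphere_seven_of_nontrivial`: `Θ₇` nontrivial + TOP
  Poincaré (`n ≥ 5`) ⇒ spc4.S12.
* `exists_homeomorph_isEmpty_diffeomorph_sphere_seven_of`: `|Θ₇| = 28` + TOP Poincaré (`n ≥ 5`) ⇒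
  spc4.S12.
* `not_forall_nonemptyDiffeomorphSphere_seven_of`: spc4.S12 ⇒ spc4.S32 (negative part).
* `exists_homeomorph_isEmpty_diffeomorph_sphere_seven_of_not_forall`,
  `exists_homeomorph_isEmpty_diffeomorph_sphere_seven_iff_not_forall`: the converse and the
  equivalence, granted TOP Poincaré (`n ≥ 5`).
* `not_forall_nonemptyDiffeomorphSphere_seven_of_natCard`: `|Θ₇| = 28` + TOP Poincaré ⇒ spc4.S32⁻.

## Deliberately not here

Milnor's own proof of Thm. 3 (the invariant `λ(M⁷) ≡ 2q(B⁸) - τ(B⁸) mod 7` of §1 via Thom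
cobordism and Hirzebruch's signature theorem, the `S³`-bundles `M⁷ₖ → S⁴` of §3 with
`p₁ = ±2(h - j)ι`, and Reeb's criterion, §2 Thm. 2): Pontryagin classes, the signature theorem and
Morse/Reeb theory are absent from Mathlib and from the tree, so a direct discharge is out of reach;
the present file only makes spc4.S12 and spc4.S32⁻ corollaries of the (deeper, also unproved)
Kervaire–Milnor count instead of independent debts.

## References

* J. Milnor, *On manifolds homeomorphic to the 7-sphere*, Ann. of Math. 64 (1956), 399–405:
  Thm. 3 (p. 403), §2 Thm. 2 (p. 401). [Milnor1956]
* M. Kervaire, J. Milnor, *Groups of homotopy spheres I*, Ann. of Math. 77 (1963): Thm. 1.2, §2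
  p. 507, table p. 504. [KervaireMilnorAnnals1963]
* S. Smale, *Generalized Poincaré's conjecture in dimensions greater than four*, Ann. of Math. 74
  (1961). [Smale1961]
-/

open scoped Manifold ContDiff
open ContinuousMap

noncomputable section

namespace Literature.Topology.FourManifolds

/-! ### spc4.S12 from a nontrivial `Θ₇` -/

/-- **Exotic 7-spheres from `Θ₇ ≠ 0`.** If `Θ₇ = HomotopySphereClass 7` (oriented homotopy
`7`-spheres modulo orientation-preserving diffeomorphism) is nontrivial and the topological
Poincaré conjecture holds in dimensions `≥ 5`
(`Literature.Topology.FourManifolds.nonempty_homeomorph_sphere_of_five_le`, used at `n = 7`), then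
there is a smooth `7`-manifold homeomorphic but not diffeomorphic to `𝕊⁷`
(`Literature.Topology.FourManifolds.exists_homeomorph_isEmpty_diffeomorph_sphere_seven`, Milnor 1956,
Thm. 3). Proof: otherwise every homotopy `7`-sphere is diffeomorphic to `𝕊⁷` (its carrier is
homeomorphic to `𝕊⁷` by the Poincaré hypothesis, so it would witness the negated existential), and
then `Θ₇` is a point by `HomotopySphereClass.subsingleton_of_nonempty_diffeomorph_sphere`
(Kervaire–Milnor 1963, §2 p. 507), contradicting nontriviality. [cite: Milnor1956, Thm. 3 (p. 403)] -/
theorem exists_homeomorph_isEmpty_diffeomorph_sphere_seven_of_nontrivial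
    (hΘ : Nontrivial (HomotopySphereClass 7))
    (hTop : nonempty_homeomorph_sphere_of_five_le.{0}) :
    exists_homeomorph_isEmpty_diffeomorph_sphere_seven := by
  by_contra hne
  have hall : ∀ S : HomotopySphere 7,
      Nonempty (S.carrier ≃ₘ⟮𝓡 7, 𝓡 7⟯ (Metric.sphere (0 : EuclideanSpace ℝ (Fin 8)) 1)) := by
    intro S
    by_contra hS
    obtain ⟨e⟩ := S.nonempty_homotopyEquiv
    obtain ⟨homeo⟩ := hTop S.carrier 7 (by norm_num) e
    exact hne ⟨S.carrier, inferInstance, inferInstance, inferInstance, homeo,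
      not_nonempty_iff.mp hS⟩
  have hsub : Subsingleton (HomotopySphereClass 7) :=
    HomotopySphereClass.subsingleton_of_nonempty_diffeomorph_sphere (by norm_num) hall
  exact false_of_nontrivial_of_subsingleton (HomotopySphereClass 7)

/-- **Milnor's exotic 7-sphere from `|Θ₇| = 28`.** The named facts
`Literature.Topology.FourManifolds.natCard_homotopySphereClass_seven` (Kervaire–Milnor 1963, Thm. 1.2
and table p. 504: `Θ₇` has `28` elements) and
`Literature.Topology.FourManifolds.nonempty_homeomorph_sphere_of_five_le` (topological Poincaré
conjecture, `n ≥ 5`) imply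
`Literature.Topology.FourManifolds.exists_homeomorph_isEmpty_diffeomorph_sphere_seven` (Milnor 1956,
Thm. 3: a smooth manifold homeomorphic but not diffeomorphic to `S⁷` exists): `28 > 1` classes make
`Θ₇` nontrivial (`nontrivial_homotopySphereClass_seven_of`). [cite: Milnor1956, Thm. 3 (p. 403)] -/
theorem exists_homeomorph_isEmpty_diffeomorph_sphere_seven_of
    (h28 : natCard_homotopySphereClass_seven)
    (hTop : nonempty_homeomorph_sphere_of_five_le.{0}) :
    exists_homeomorph_isEmpty_diffeomorph_sphere_seven :=
  exists_homeomorph_isEmpty_diffeomorph_sphere_seven_of_nontrivial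
    (nontrivial_homotopySphereClass_seven_of h28) hTop

/-! ### spc4.S32 (negative part) versus spc4.S12 -/

/-- **The smooth Poincaré conjecture fails in dimension `7`, from an exotic `7`-sphere.** If some
smooth `7`-manifold `M` is homeomorphic but not diffeomorphic to `𝕊⁷`
(`Literature.Topology.FourManifolds.exists_homeomorph_isEmpty_diffeomorph_sphere_seven`, Milnor 1956,
Thm. 3), then not every Hausdorff second-countable smooth `7`-manifold homotopy equivalent to `𝕊⁷`
is diffeomorphic to it
(`Literature.Topology.FourManifolds.not_forall_nonemptyDiffeomorphSphere_seven`): `M` is Hausdorff and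
second countable (transported along the homeomorphism), homotopy equivalent to `𝕊⁷`
(`Homeomorph.toHomotopyEquiv`), and Mathlib's
`ContinuousMap.HomotopyEquiv.NonemptyDiffeomorphSphere M 7` would then produce the excluded
diffeomorphism. [cite: Milnor1956, Thm. 3 (p. 403)] -/
theorem not_forall_nonemptyDiffeomorphSphere_seven_of
    (h : exists_homeomorph_isEmpty_diffeomorph_sphere_seven) :
    not_forall_nonemptyDiffeomorphSphere_seven := by
  intro hall
  obtain ⟨M, _, _, _, homeo, hempty⟩ := h
  haveI : T2Space M := homeo.symm.t2Space
  haveI : SecondCountableTopology M := homeo.secondCountableTopology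
  obtain ⟨φ⟩ := hall M ‹_› ‹_› homeo.toHomotopyEquiv
  exact hempty.false φ

/-- **Converse, granted the topological Poincaré conjecture in dimension `7`.** If the smooth
Poincaré conjecture fails in dimension `7`
(`Literature.Topology.FourManifolds.not_forall_nonemptyDiffeomorphSphere_seven`) and homotopy
`7`-spheres are homeomorphic to `𝕊⁷`
(`Literature.Topology.FourManifolds.nonempty_homeomorph_sphere_of_five_le` at `n = 7`; Smale 1961),
then an exotic `7`-sphere in the sense of
`Literature.Topology.FourManifolds.exists_homeomorph_isEmpty_diffeomorph_sphere_seven` exists: the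
offending manifold is homotopy equivalent, hence homeomorphic, to `𝕊⁷`, and not diffeomorphic to it
(Milnor 1956, Thm. 3 with §2 Thm. 2). [cite: Milnor1956, Thm. 3 (p. 403) with §2 Thm. 2 (p. 401)] -/
theorem exists_homeomorph_isEmpty_diffeomorph_sphere_seven_of_not_forall
    (h : not_forall_nonemptyDiffeomorphSphere_seven)
    (hTop : nonempty_homeomorph_sphere_of_five_le.{0}) :
    exists_homeomorph_isEmpty_diffeomorph_sphere_seven := by
  by_contra hne
  refine h fun M _ _ _ => ?_
  intro _ _ e
  by_contra hφ
  obtain ⟨homeo⟩ := hTop M 7 (by norm_num) e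
  exact hne ⟨M, _, _, ‹_›, homeo, not_nonempty_iff.mp hφ⟩

/-- **spc4.S12 ⇔ spc4.S32⁻, granted TOP Poincaré in dimension `7`.** Under
`Literature.Topology.FourManifolds.nonempty_homeomorph_sphere_of_five_le`, the existence of a smooth
`7`-manifold homeomorphic but not diffeomorphic to `𝕊⁷` (Milnor 1956, Thm. 3) is equivalent to the
failure of the smooth Poincaré conjecture in dimension `7`
(`not_forall_nonemptyDiffeomorphSphere_seven_of`,
`exists_homeomorph_isEmpty_diffeomorph_sphere_seven_of_not_forall`). [cite: Milnor1956, Thm. 3 (p. 403)] -/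
theorem exists_homeomorph_isEmpty_diffeomorph_sphere_seven_iff_not_forall
    (hTop : nonempty_homeomorph_sphere_of_five_le.{0}) :
    exists_homeomorph_isEmpty_diffeomorph_sphere_seven ↔
      not_forall_nonemptyDiffeomorphSphere_seven :=
  ⟨not_forall_nonemptyDiffeomorphSphere_seven_of,
    fun h => exists_homeomorph_isEmpty_diffeomorph_sphere_seven_of_not_forall h hTop⟩

/-- **spc4.S32⁻ from `|Θ₇| = 28`.** The named facts
`Literature.Topology.FourManifolds.natCard_homotopySphereClass_seven` (Kervaire–Milnor 1963, table
p. 504) and `Literature.Topology.FourManifolds.nonempty_homeomorph_sphere_of_five_le` (TOP Poincaré,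
`n ≥ 5`) imply that the smooth Poincaré conjecture fails in dimension `7`
(`Literature.Topology.FourManifolds.not_forall_nonemptyDiffeomorphSphere_seven`; Milnor 1956,
Kervaire–Milnor 1963). [cite: KervaireMilnorAnnals1963, Thm. 1.2 and table p. 504] -/
theorem not_forall_nonemptyDiffeomorphSphere_seven_of_natCard
    (h28 : natCard_homotopySphereClass_seven)
    (hTop : nonempty_homeomorph_sphere_of_five_le.{0}) :
    not_forall_nonemptyDiffeomorphSphere_seven :=
  not_forall_nonemptyDiffeomorphSphere_seven_of
    (exists_homeomorph_isEmpty_diffeomorph_sphere_seven_of h28 hTop)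

end Literature.Topology.FourManifolds
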